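import Literature.Analysis.OperatorTheory.TwoDominantEigenvalues
import Literature.Analysis.OperatorTheory.SimpleEigenvalueDerivative
import HarnessLib

/-!
# Two dominant simple eigenvalues: Hellmann–Feynman formulas for the two branches and the
  first-order criterion for Beraha–Kahane–Weiss zeros

Analysis/OperatorTheory proofs-layer file (theorems only, no definitions, no named facts),
continuing `TwoDominantEigenvalues.lean` (`exists_zero_of_tied_dominant_eigenvalues`, whose last
hypothesis is the NON-CONSTANCY of the ratio `λ₁(ϰ)/λ₀(ϰ)` of the two eigenvalue branches) and
`SimpleEigenvalueDerivative.lean` (Kato II-(2.36) for `m = 1`: `P T′ P = μ′ P`, Banach-space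
Hellmann–Feynman). For the annulus branch `T(ϰ)(P_{s₁} − P_{s₀}) = λ₀(ϰ)(P_{s₁} − P_{s₀})` and the
outer branch `T(ϰ)(1 − P_{s₁}) = λ₁(ϰ)(1 − P_{s₁})` we prove

* `eq_of_mul_eq_smul_of_mul_eq_smul` — the scalar `μ` in `T Π = μ Π` is unique once `Π ≠ 0`
  (so ANY local branch coincides with the holomorphic one);
* `deriv_eigenvalue_branch_sub_rieszProjection`, `deriv_eigenvalue_branch_one_sub_rieszProjection`
  — **`λ_j′(ϰ₀) ψ(v) = ψ(T′(ϰ₀) v)`** for a vector `v` fixed by `Π_j(ϰ₀)` and a functional `ψ`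
  invariant under `Π_j(ϰ₀)` (right/left eigenvectors; Kato II-(2.36));
* **`exists_zero_of_tied_dominant_eigenvalues_of_deriv`** — the zero theorem with the
  non-constancy hypothesis replaced by the checkable FIRST-ORDER condition
  `μ₀ ψ₁(T′(ϰ₀) x₁) ≠ μ₁ ψ₀(T′(ϰ₀) x₀)` (i.e. `(λ₁/λ₀)′(ϰ₀) ≠ 0` by Hellmann–Feynman with the
  normalisations `ψ_j(x_j) = 1`): every hypothesis is now a statement about `T(ϰ₀)`, `T′(ϰ₀)` and
  the data at `ϰ₀`.

## Mathlib / tree search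

Tree: `deriv_eigenvalue_mul_eq_of_apply_eq` (generic `P`), `hasDerivAt_rieszProjection_comp`,
`exists_two_dominant_eigenvalues_asymptotics`, `exists_zero_of_tied_dominant_eigenvalues`,
`ne_zero_of_finrank_range_eq_one`; Mathlib `HasDerivAt.congr_of_eventuallyEq`, `HasDerivAt.unique`.

## References

* T. Kato, *Perturbation Theory for Linear Operators*, Springer 1966, II-§2.2 (2.33)–(2.36),
  VII-§1.3 Thm. 1.7–1.8, III-§6.4–6.5 (held copy
  `book:kato1966-perturbation-theory-linear-operators`). [Kato1966]
* S. Beraha, J. Kahane, N. J. Weiss, *Limits of zeroes of recursively defined polynomials*,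
  Proc. Nat. Acad. Sci. USA 72 (1975), 4209, Theorem (non-degenerate two-term case). [BerahaKahaneWeiss1975]
-/

noncomputable section

open Complex MeasureTheory Metric Set Filter Topology

namespace Literature.Analysis.OperatorTheory

variable {E : Type*} [NormedAddCommGroup E] [NormedSpace ℂ E] [CompleteSpace E]

omit [CompleteSpace E] in
/-- **The scalar on a non-zero spectral subspace is unique**: `T Π = μ Π` and `T Π = ν Π` with
`Π ≠ 0` force `μ = ν`. [cite: Kato1966, II-§2.1 (2.5)–(2.7)] -/
theorem eq_of_mul_eq_smul_of_mul_eq_smul {T P : E →L[ℂ] E} {μ ν : ℂ} (hP : P ≠ 0)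
    (h1 : T * P = μ • P) (h2 : T * P = ν • P) : μ = ν := by
  have h : (μ - ν) • P = 0 := by rw [sub_smul, ← h1, ← h2, sub_self]
  exact sub_eq_zero.1 ((smul_eq_zero.1 h).resolve_right hP)

/-- **Hellmann–Feynman for the annulus branch**: if `T(ϰ)(P_{s₁} − P_{s₀}) = μ(ϰ)(P_{s₁} − P_{s₀})`
on a ball around `ϰ₀` with `μ` differentiable there (the situation produced by
`exists_two_dominant_eigenvalues_asymptotics`), then `deriv μ ϰ₀ · ψ(v) = ψ(T′(ϰ₀) v)` for every
`v` fixed by the annulus projection at `ϰ₀` and every functional `ψ` invariant under it.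
[cite: Kato1966, II-§2.2 (2.36) and VII-§1.3 Thm. 1.8] -/
theorem deriv_eigenvalue_branch_sub_rieszProjection {T : ℂ → E →L[ℂ] E} {U : Set ℂ}
    (hU : IsOpen U) (hT : DifferentiableOn ℂ T U) {a₀ : ℂ} (ha₀ : a₀ ∈ U) {c : ℂ} {s₀ s₁ : ℝ}
    (hs₀ : 0 < s₀) (h01 : s₀ ≤ s₁) (hS₀ : sphere c s₀ ⊆ resolventSet ℂ (T a₀))
    (hS₁ : sphere c s₁ ⊆ resolventSet ℂ (T a₀)) {ε : ℝ} (hε : 0 < ε) {μ : ℂ → ℂ}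
    (hμd : DifferentiableOn ℂ μ (ball a₀ ε))
    (hμ : ∀ a ∈ ball a₀ ε, T a * (rieszProjection (T a) c s₁ - rieszProjection (T a) c s₀) =
      μ a • (rieszProjection (T a) c s₁ - rieszProjection (T a) c s₀))
    {v : E} (hv : (rieszProjection (T a₀) c s₁ - rieszProjection (T a₀) c s₀) v = v)
    {ψ : E →L[ℂ] ℂ}
    (hψ : ∀ x, ψ ((rieszProjection (T a₀) c s₁ - rieszProjection (T a₀) c s₀) x) = ψ x) :
    deriv μ a₀ * ψ v = ψ (deriv T a₀ v) := by
  have hs₁ : 0 < s₁ := hs₀.trans_le h01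
  have hball : ball a₀ ε ∈ 𝓝 a₀ := ball_mem_nhds a₀ hε
  have hTP : ∀ᶠ a in 𝓝 a₀, T a * (rieszProjection (T a) c s₁ - rieszProjection (T a) c s₀) =
      μ a • (rieszProjection (T a) c s₁ - rieszProjection (T a) c s₀) :=
    Filter.eventually_of_mem hball hμ
  exact deriv_eigenvalue_mul_eq_of_apply_eq
    (P := fun a => rieszProjection (T a) c s₁ - rieszProjection (T a) c s₀) hTP
    (hT.hasDerivAt (hU.mem_nhds ha₀))
    ((hasDerivAt_rieszProjection_comp hU hT ha₀ hs₁.le hS₁).sub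
      (hasDerivAt_rieszProjection_comp hU hT ha₀ hs₀.le hS₀))
    (hμd.hasDerivAt hball) (sub_rieszProjection_mul_self hs₀ h01 hS₀ hS₁)
    (commute_sub_rieszProjection hs₀.le hs₁.le hS₀ hS₁) hv hψ

/-- **Hellmann–Feynman for the outer branch** `T(ϰ)(1 − P_{s₁}) = μ(ϰ)(1 − P_{s₁})`:
`deriv μ ϰ₀ · ψ(v) = ψ(T′(ϰ₀) v)` for `v` fixed by `1 − P_{s₁}[T(ϰ₀)]` and `ψ` invariant under it.
[cite: Kato1966, II-§2.2 (2.36) and VII-§1.3 Thm. 1.8] -/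
theorem deriv_eigenvalue_branch_one_sub_rieszProjection {T : ℂ → E →L[ℂ] E} {U : Set ℂ}
    (hU : IsOpen U) (hT : DifferentiableOn ℂ T U) {a₀ : ℂ} (ha₀ : a₀ ∈ U) {c : ℂ} {s₁ : ℝ}
    (hs₁ : 0 < s₁) (hS₁ : sphere c s₁ ⊆ resolventSet ℂ (T a₀)) {ε : ℝ} (hε : 0 < ε) {μ : ℂ → ℂ}
    (hμd : DifferentiableOn ℂ μ (ball a₀ ε))
    (hμ : ∀ a ∈ ball a₀ ε, T a * (1 - rieszProjection (T a) c s₁) =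
      μ a • (1 - rieszProjection (T a) c s₁))
    {v : E} (hv : (1 - rieszProjection (T a₀) c s₁) v = v) {ψ : E →L[ℂ] ℂ}
    (hψ : ∀ x, ψ ((1 - rieszProjection (T a₀) c s₁) x) = ψ x) :
    deriv μ a₀ * ψ v = ψ (deriv T a₀ v) := by
  have hball : ball a₀ ε ∈ 𝓝 a₀ := ball_mem_nhds a₀ hε
  have hTP : ∀ᶠ a in 𝓝 a₀, T a * (1 - rieszProjection (T a) c s₁) =
      μ a • (1 - rieszProjection (T a) c s₁) := Filter.eventually_of_mem hball hμ
  exact deriv_eigenvalue_mul_eq_of_apply_eq (P := fun a => 1 - rieszProjection (T a) c s₁) hTP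
    (hT.hasDerivAt (hU.mem_nhds ha₀))
    ((hasDerivAt_const a₀ (1 : E →L[ℂ] E)).sub
      (hasDerivAt_rieszProjection_comp hU hT ha₀ hs₁.le hS₁))
    (hμd.hasDerivAt hball) (one_sub_rieszProjection_mul_self hs₁ hS₁)
    (commute_one_sub_rieszProjection hs₁.le hS₁) hv hψ

/-- **Beraha–Kahane–Weiss zeros from first-order data.** In the situation of
`exists_zero_of_tied_dominant_eigenvalues` (two simple eigenvalues `μ₀` (annulus) and `μ₁` (outer)
of `T(ϰ₀)` with eigenvectors `x₀, x₁`, tied in modulus and dominating the rest; holomorphic data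
`v, w` with non-vanishing amplitudes at `ϰ₀`), let `ψ₀, ψ₁` be functionals invariant under the
respective spectral projections at `ϰ₀` and normalised by `ψ_j(x_j) = 1` (left eigenvectors). If
`μ₀ ψ₁(T′(ϰ₀) x₁) ≠ μ₁ ψ₀(T′(ϰ₀) x₀)` — by Hellmann–Feynman `λ_j′(ϰ₀) = ψ_j(T′(ϰ₀) x_j)`, this
says `(λ₁/λ₀)′(ϰ₀) ≠ 0` — then the ratio of the branches is not locally constant and
`ϰ ↦ ⟨w(ϰ), T(ϰ)ⁿ v(ϰ)⟩` has a zero near `ϰ₀` for all large `n`.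
[cite: BerahaKahaneWeiss1975, Theorem (non-degenerate two-term case)] -/
theorem exists_zero_of_tied_dominant_eigenvalues_of_deriv {T : ℂ → E →L[ℂ] E} {U : Set ℂ}
    (hU : IsOpen U) (hT : DifferentiableOn ℂ T U) {a₀ : ℂ} (ha₀ : a₀ ∈ U) {c : ℂ} {s₀ s₁ : ℝ}
    (hs₀ : 0 < s₀) (h01 : s₀ < s₁) (hS₀ : sphere c s₀ ⊆ resolventSet ℂ (T a₀))
    (hS₁ : sphere c s₁ ⊆ resolventSet ℂ (T a₀))
    (h0 : Module.finrank ℂ (LinearMap.range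
      ((rieszProjection (T a₀) c s₁ - rieszProjection (T a₀) c s₀ : E →L[ℂ] E) : E →ₗ[ℂ] E)) = 1)
    (h1 : Module.finrank ℂ (LinearMap.range
      ((1 - rieszProjection (T a₀) c s₁ : E →L[ℂ] E) : E →ₗ[ℂ] E)) = 1)
    {w : ℂ → E →L[ℂ] ℂ} {v : ℂ → E} (hw : DifferentiableOn ℂ w U) (hv : DifferentiableOn ℂ v U)
    {μ₀ μ₁ : ℂ} {x₀ x₁ : E} (hx₀ : T a₀ x₀ = μ₀ • x₀) (hx₀0 : x₀ ≠ 0)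
    (hμ₀ : μ₀ ∉ closedBall c s₀) (hμ₀' : μ₀ ∈ ball c s₁) (hx₁ : T a₀ x₁ = μ₁ • x₁) (hx₁0 : x₁ ≠ 0)
    (hμ₁ : μ₁ ∉ closedBall c s₁) (htie : ‖μ₁‖ = ‖μ₀‖) (hdom : ‖c‖ + s₀ < ‖μ₀‖)
    (hamp₀ : w a₀ ((rieszProjection (T a₀) c s₁ - rieszProjection (T a₀) c s₀) (v a₀)) ≠ 0)
    (hamp₁ : w a₀ ((1 - rieszProjection (T a₀) c s₁) (v a₀)) ≠ 0)
    {ψ₀ ψ₁ : E →L[ℂ] ℂ}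
    (hψ₀ : ∀ x, ψ₀ ((rieszProjection (T a₀) c s₁ - rieszProjection (T a₀) c s₀) x) = ψ₀ x)
    (hψ₁ : ∀ x, ψ₁ ((1 - rieszProjection (T a₀) c s₁) x) = ψ₁ x) (hψ₀x : ψ₀ x₀ = 1)
    (hψ₁x : ψ₁ x₁ = 1) (hHF : μ₀ * ψ₁ (deriv T a₀ x₁) ≠ μ₁ * ψ₀ (deriv T a₀ x₀)) :
    ∃ ε : ℝ, 0 < ε ∧ ball a₀ ε ⊆ U ∧ ∃ n₀ : ℕ, ∀ n : ℕ, n₀ ≤ n →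
      ∃ a ∈ ball a₀ ε, w a ((T a ^ n) (v a)) = 0 := by
  have hs₁ : 0 < s₁ := hs₀.trans h01
  -- the canonical holomorphic branches
  obtain ⟨ε₁, hε₁, -, lam₀, lam₁, M, -, hlam₀d, hlam₁d, -, -, hall⟩ :=
    exists_two_dominant_eigenvalues_asymptotics hU hT ha₀ hs₀ h01 hS₀ hS₁ h0 h1
  have ha₀b : a₀ ∈ ball a₀ ε₁ := mem_ball_self hε₁
  have hQx₀ : (rieszProjection (T a₀) c s₁ - rieszProjection (T a₀) c s₀) x₀ = x₀ :=
    sub_rieszProjection_apply_of_mem_annulus hx₀ hs₀.le hμ₀ hμ₀' hS₀ hS₁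
  have hRx₁ : (1 - rieszProjection (T a₀) c s₁) x₁ = x₁ :=
    one_sub_rieszProjection_apply_of_not_mem_closedBall hx₁ hs₁.le hμ₁ hS₁
  have hlam₀a₀ : lam₀ a₀ = μ₀ :=
    eq_of_mul_eq_smul_of_apply_eq_self hx₀ hx₀0 hQx₀ (hall a₀ ha₀b).2.2.2.2.1
  have hlam₁a₀ : lam₁ a₀ = μ₁ :=
    eq_of_mul_eq_smul_of_apply_eq_self hx₁ hx₁0 hRx₁ (hall a₀ ha₀b).2.2.2.2.2.1
  -- their derivatives at `a₀` (Hellmann–Feynman)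
  have hd₀ : deriv lam₀ a₀ = ψ₀ (deriv T a₀ x₀) := by
    have h := deriv_eigenvalue_branch_sub_rieszProjection hU hT ha₀ hs₀ h01.le hS₀ hS₁ hε₁ hlam₀d
      (fun a ha => (hall a ha).2.2.2.2.1) hQx₀ hψ₀
    rwa [hψ₀x, mul_one] at h
  have hd₁ : deriv lam₁ a₀ = ψ₁ (deriv T a₀ x₁) := by
    have h := deriv_eigenvalue_branch_one_sub_rieszProjection hU hT ha₀ hs₁ hS₁ hε₁ hlam₁d
      (fun a ha => (hall a ha).2.2.2.2.2.1) hRx₁ hψ₁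
    rwa [hψ₁x, mul_one] at h
  have hball₁ : ball a₀ ε₁ ∈ 𝓝 a₀ := ball_mem_nhds a₀ hε₁
  have hD₀ : HasDerivAt lam₀ (ψ₀ (deriv T a₀ x₀)) a₀ := hd₀ ▸ (hlam₀d.hasDerivAt hball₁)
  have hD₁ : HasDerivAt lam₁ (ψ₁ (deriv T a₀ x₁)) a₀ := hd₁ ▸ (hlam₁d.hasDerivAt hball₁)
  -- non-constancy of the ratio of ANY local branches
  refine exists_zero_of_tied_dominant_eigenvalues hU hT ha₀ hs₀ h01 hS₀ hS₁ h0 h1 hw hv hx₀ hx₀0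
    hμ₀ hμ₀' hx₁ hx₁0 hμ₁ htie hdom hamp₀ hamp₁ fun lam₀' lam₁' ε hε hbr => ?_
  by_contra hcon
  push Not at hcon
  -- the given branches agree with the canonical ones near `a₀`
  set δ := min ε ε₁ with hδ
  have hδpos : 0 < δ := lt_min hε hε₁
  have hbε : ball a₀ δ ⊆ ball a₀ ε := ball_subset_ball (min_le_left _ _)
  have hbε₁ : ball a₀ δ ⊆ ball a₀ ε₁ := ball_subset_ball (min_le_right _ _)
  have hballδ : ball a₀ δ ∈ 𝓝 a₀ := ball_mem_nhds a₀ hδpos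
  have heq₀ : ∀ a ∈ ball a₀ δ, lam₀' a = lam₀ a := fun a ha => by
    have hQ0 : (rieszProjection (T a) c s₁ - rieszProjection (T a) c s₀) ≠ 0 :=
      ne_zero_of_finrank_range_eq_one (hall a (hbε₁ ha)).2.2.1
    exact eq_of_mul_eq_smul_of_mul_eq_smul hQ0 (hbr a (hbε ha)).1 (hall a (hbε₁ ha)).2.2.2.2.1
  have heq₁ : ∀ a ∈ ball a₀ δ, lam₁' a = lam₁ a := fun a ha => by
    have hR0 : (1 - rieszProjection (T a) c s₁) ≠ 0 :=
      ne_zero_of_finrank_range_eq_one (hall a (hbε₁ ha)).2.2.2.1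
    exact eq_of_mul_eq_smul_of_mul_eq_smul hR0 (hbr a (hbε ha)).2 (hall a (hbε₁ ha)).2.2.2.2.2.1
  have ha₀δ : a₀ ∈ ball a₀ δ := mem_ball_self hδpos
  have hl₀' : lam₀' a₀ = μ₀ := by rw [heq₀ a₀ ha₀δ, hlam₀a₀]
  have hl₁' : lam₁' a₀ = μ₁ := by rw [heq₁ a₀ ha₀δ, hlam₁a₀]
  have hμ₀0 : μ₀ ≠ 0 := by
    have : 0 < ‖μ₀‖ := lt_of_le_of_lt (by positivity) hdom
    exact norm_pos_iff.1 this
  -- on `ball a₀ ε`: `lam₁' a = κ lam₀' a` with `κ = μ₁/μ₀`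
  set κ : ℂ := μ₁ / μ₀ with hκ
  have hprop : ∀ a ∈ ball a₀ δ, lam₁' a = κ * lam₀' a := fun a ha => by
    have h := hcon a (hbε ha)
    rw [hl₀', hl₁'] at h
    -- `lam₀' a ≠ 0` is NOT needed: if `lam₀' a = 0` then `h` reads `0 = μ₁/μ₀`... handle both cases
    by_cases h0 : lam₀' a = 0
    · -- then `lam₁' a / 0 = 0 = μ₁/μ₀` forces `μ₁ = 0`, contradicting the tie with `μ₀ ≠ 0`
      exfalso
      rw [h0, div_zero] at h
      have hμ₁0 : μ₁ = 0 := by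
        rcases div_eq_zero_iff.1 h.symm with h' | h'
        · exact h'
        · exact absurd h' hμ₀0
      rw [hμ₁0, norm_zero] at htie
      exact hμ₀0 (norm_eq_zero.1 htie.symm)
    · rw [hκ, ← h, div_mul_cancel₀ _ h0]
  -- differentiate `lam₁' = κ lam₀'` at `a₀`
  have hD₀' : HasDerivAt lam₀' (ψ₀ (deriv T a₀ x₀)) a₀ :=
    hD₀.congr_of_eventuallyEq (Filter.eventually_of_mem hballδ fun a ha => heq₀ a ha)
  have hD₁' : HasDerivAt lam₁' (ψ₁ (deriv T a₀ x₁)) a₀ :=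
    hD₁.congr_of_eventuallyEq (Filter.eventually_of_mem hballδ fun a ha => heq₁ a ha)
  have hD₁'' : HasDerivAt lam₁' (κ * ψ₀ (deriv T a₀ x₀)) a₀ :=
    (hD₀'.const_mul κ).congr_of_eventuallyEq
      (Filter.eventually_of_mem hballδ fun a ha => hprop a ha)
  have hderiv : ψ₁ (deriv T a₀ x₁) = κ * ψ₀ (deriv T a₀ x₀) := hD₁'.unique hD₁''
  apply hHF
  rw [hderiv, hκ]
  field_simp

end Literature.Analysis.OperatorTheory
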